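import Mathlib.MeasureTheory.Integral.IntervalIntegral.Basic
import HarnessLib

/-!
# Oscillatory processes for Scheffer's NSI block, I: square waves (Ożański 2017, §4.3)

Support file for the barrier `NavierStokesInequalitySingularSolution` (Scheffer 1985), on the
discharge path of the named fact `Scheffer.FieldOfGeometricArrangement` (Ożański 2017, §4):
Proposition 9 there is proved with the **oscillatory processes** `a₁ᵏ, a₂ᵏ ∈ C^∞(ℝ; [-1,1])` of
W. S. Ożański, arXiv:1709.00602, Theorem 10 (§4.3), which are smoothings of the square waves
`bᵢᵏ(t) = bᵢ(kt)` ((4.28)), `b₁ = 1, -1, 0` on `(0,T/4), (T/4,T/2), (T/2,T)` and `b₂ = 1, -1` on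
`(0,T/2), (T/2,T)` ((4.24)), extended `T`-periodically. The whole of Theorem 10 rests on one
estimate, the computation (4.30)–(4.31) (pp. 18–19): for a continuous `f` on `[0,T]` with
oscillation `≤ ε` at scale `T/k` and `|f| ≤ N`, and a square wave `w` taking the values
`c₀, c₁, c₂, c₃` (`|cⱼ| ≤ 1`) on the four quarters of each period of length `T/k`,
`|∫₀ᵗ w f - ((c₀+c₁+c₂+c₃)/4) ∫₀ᵗ f| ≤ 2Tε + 2N·T/k` uniformly in `t ∈ [0,T]`
(full periods contribute `T·O(ε)` because `∫_{period} (w - mean) = 0`, the last incomplete period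
contributes `O(N T/k)`). This file proves that estimate (`abs_integral_wave_mul_sub_le`) for the
explicit square waves `wave c h` (quarter length `h = T/(4k)`); the sequel assembles Theorem 10.

## Contents

* `quarterIndex h s = ⌊s/h⌋ mod 4`, `wave c h s = c (quarterIndex h s)`: the square wave with
  quarter values `c : Fin 4 → ℝ` and quarter length `h` (so `b₁ᵏ = wave ![1,-1,0,0] (T/(4k))`,
  `b₂ᵏ = wave ![1,1,-1,-1] (T/(4k))` on `[0,T)`);
* `wave_eqOn`: `wave c h = c (m mod 4)` on the open quarter `(mh, (m+1)h)`;
* `integral_wave_period`: `∫_{4ph}^{4(p+1)h} wave c h = h Σⱼ cⱼ`;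
* `intervalIntegrable_wave_mul`: `wave c h · ψ` is integrable on subintervals of `[0, nh]` for
  `ψ` continuous there;
* `abs_integral_wave_mul_sub_le`: the estimate above.

## References

* W. S. Ożański, arXiv:1709.00602 (2017), §4.3: (4.24)–(4.31), proof of Theorem 10.
  [`Ozanski2017NSIInternal`]
-/

noncomputable section

open Set MeasureTheory intervalIntegral
open scoped Interval

namespace Literature.Barriers.NavierStokesRegularity

namespace Scheffer

/-! ### Square waves -/

/-- The index `⌊s/h⌋ mod 4 ∈ {0,1,2,3}` of the quarter (of length `h`) containing `s`, within its
period of length `4h` (Ożański 2017, (4.24)/(4.28): the processes `bᵢᵏ` are constant on the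
quarters of each period `[pT/k, (p+1)T/k]`, `h = T/(4k)`). [cite: Ozanski2017NSIInternal, §4.3 (4.24) and (4.28)] -/
def quarterIndex (h s : ℝ) : Fin 4 :=
  ⟨(⌊s / h⌋).toNat % 4, Nat.mod_lt _ (by norm_num)⟩

/-- The square wave with quarter values `c = (c₀, c₁, c₂, c₃)` and quarter length `h`:
`wave c h s = c_{⌊s/h⌋ mod 4}`; Ożański's `b₁ᵏ = wave (1,-1,0,0) (T/(4k))` and
`b₂ᵏ = wave (1,1,-1,-1) (T/(4k))` on `[0,T)` ((4.24), (4.28)). [cite: Ozanski2017NSIInternal, §4.3 (4.24) and (4.28)] -/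
def wave (c : Fin 4 → ℝ) (h s : ℝ) : ℝ :=
  c (quarterIndex h s)

/-- On the open quarter `(mh, (m+1)h)` the quarter index is `m mod 4`. [folklore] -/
theorem quarterIndex_eq {h : ℝ} (hh : 0 < h) (m : ℕ) {s : ℝ}
    (hs : s ∈ Ioo ((m : ℝ) * h) (((m : ℝ) + 1) * h)) :
    quarterIndex h s = ⟨m % 4, Nat.mod_lt _ (by norm_num)⟩ := by
  have h1 : (m : ℝ) < s / h := by
    rw [lt_div_iff₀ hh]
    exact hs.1
  have h2 : s / h < (m : ℝ) + 1 := by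
    rw [div_lt_iff₀ hh]
    exact hs.2
  have hfloor : ⌊s / h⌋ = (m : ℤ) := by
    rw [Int.floor_eq_iff]
    exact ⟨by exact_mod_cast h1.le, by exact_mod_cast h2⟩
  apply Fin.ext
  simp [quarterIndex, hfloor]

/-- On the open quarter `(mh, (m+1)h)` the square wave equals `c_{m mod 4}`. [cite: Ozanski2017NSIInternal, §4.3 (4.24)] -/
theorem wave_eqOn {h : ℝ} (hh : 0 < h) (c : Fin 4 → ℝ) (m : ℕ) :
    EqOn (wave c h) (fun _ => c ⟨m % 4, Nat.mod_lt _ (by norm_num)⟩)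
      (Ioo ((m : ℝ) * h) (((m : ℝ) + 1) * h)) := fun s hs => by
  simp only [wave, quarterIndex_eq hh m hs]

/-- The square wave is bounded by the largest quarter value. [folklore] -/
theorem abs_wave_le {c : Fin 4 → ℝ} {M : ℝ} (hc : ∀ j, |c j| ≤ M) (h s : ℝ) : |wave c h s| ≤ M :=
  hc _

/-- Shifting all quarter values shifts the wave: `wave (c - m) = wave c - m`. [folklore] -/
theorem wave_sub_const (c : Fin 4 → ℝ) (m h s : ℝ) :
    wave (fun j => c j - m) h s = wave c h s - m :=
  rfl

/-- The integral of the square wave over one quarter: `∫_{mh}^{(m+1)h} wave c h = h c_{m mod 4}`. [folklore] -/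
theorem integral_wave_quarter {h : ℝ} (hh : 0 < h) (c : Fin 4 → ℝ) (m : ℕ) :
    ∫ s in ((m : ℝ) * h)..(((m : ℝ) + 1) * h), wave c h s =
      h * c ⟨m % 4, Nat.mod_lt _ (by norm_num)⟩ := by
  have hle : (m : ℝ) * h ≤ ((m : ℝ) + 1) * h := by nlinarith
  rw [integral_congr_uIoo (g := fun _ => c ⟨m % 4, Nat.mod_lt _ (by norm_num)⟩)]
  · rw [intervalIntegral.integral_const, smul_eq_mul]
    ring
  · rw [uIoo_of_le hle]
    exact wave_eqOn hh c m

/-- **The square wave has the prescribed mean over each period**: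
`∫_{4ph}^{(4p+4)h} wave c h = h (c₀ + c₁ + c₂ + c₃)` (Ożański 2017, (4.25): the processes "pick"
exactly the designed averages). [cite: Ozanski2017NSIInternal, §4.3 (4.25)] -/
theorem integral_wave_period {h : ℝ} (hh : 0 < h) (c : Fin 4 → ℝ) (p : ℕ) :
    ∫ s in (((4 * p : ℕ) : ℝ) * h)..(((4 * p + 4 : ℕ) : ℝ) * h), wave c h s = h * ∑ j, c j := by
  have key := sum_integral_adjacent_intervals (f := wave c h) (μ := volume)
    (a := fun i : ℕ => ((4 * p + i : ℕ) : ℝ) * h) (n := 4) fun i _ => by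
      have e : (((4 * p + (i + 1) : ℕ) : ℝ)) = ((4 * p + i : ℕ) : ℝ) + 1 := by push_cast; ring
      rw [e]
      refine IntervalIntegrable.congr_uIoo (f := fun _ => c ⟨(4 * p + i) % 4, Nat.mod_lt _ (by norm_num)⟩)
        intervalIntegrable_const ?_
      rw [uIoo_of_le (by nlinarith)]
      exact (wave_eqOn hh c (4 * p + i)).symm
  simp only [add_zero] at key
  have e : ∀ i : ℕ, (((4 * p + (i + 1) : ℕ) : ℝ)) = ((4 * p + i : ℕ) : ℝ) + 1 := fun i => by
    push_cast; ring
  have term : ∀ i : ℕ, ∫ s in (((4 * p + i : ℕ) : ℝ) * h)..(((4 * p + (i + 1) : ℕ) : ℝ) * h),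
      wave c h s = h * c ⟨(4 * p + i) % 4, Nat.mod_lt _ (by norm_num)⟩ := fun i => by
    rw [e i]
    exact integral_wave_quarter hh c (4 * p + i)
  rw [← key, Finset.sum_range_succ, Finset.sum_range_succ, Finset.sum_range_succ,
    Finset.sum_range_succ, Finset.sum_range_zero, zero_add, term 0, term 1, term 2, term 3]
  have f0 : (⟨(4 * p + 0) % 4, Nat.mod_lt _ (by norm_num)⟩ : Fin 4) = 0 :=
    Fin.ext (show (4 * p + 0) % 4 = 0 by omega)
  have f1 : (⟨(4 * p + 1) % 4, Nat.mod_lt _ (by norm_num)⟩ : Fin 4) = 1 :=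
    Fin.ext (show (4 * p + 1) % 4 = 1 by omega)
  have f2 : (⟨(4 * p + 2) % 4, Nat.mod_lt _ (by norm_num)⟩ : Fin 4) = 2 :=
    Fin.ext (show (4 * p + 2) % 4 = 2 by omega)
  have f3 : (⟨(4 * p + 3) % 4, Nat.mod_lt _ (by norm_num)⟩ : Fin 4) = 3 :=
    Fin.ext (show (4 * p + 3) % 4 = 3 by omega)
  rw [f0, f1, f2, f3, Fin.sum_univ_four]
  ring

/-- **Integrability of `wave · ψ`** on `[0, nh]` for `ψ` continuous on `[0, nh]` (the wave is
piecewise constant on the quarters). [folklore] -/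
theorem intervalIntegrable_wave_mul {h : ℝ} (hh : 0 < h) (c : Fin 4 → ℝ) {ψ : ℝ → ℝ} (n : ℕ)
    (hψ : ContinuousOn ψ (Icc 0 ((n : ℝ) * h))) :
    IntervalIntegrable (fun s => wave c h s * ψ s) volume 0 ((n : ℝ) * h) := by
  have key := IntervalIntegrable.trans_iterate (f := fun s => wave c h s * ψ s) (μ := volume)
    (a := fun i : ℕ => (i : ℝ) * h) (n := n) fun i hi => by
      have hle : (i : ℝ) * h ≤ ((i : ℝ) + 1) * h := by nlinarith
      have hsub : Icc ((i : ℝ) * h) (((i : ℝ) + 1) * h) ⊆ Icc 0 ((n : ℝ) * h) := by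
        refine Icc_subset_Icc (by positivity) ?_
        have : (i : ℝ) + 1 ≤ n := by exact_mod_cast hi
        nlinarith
      have hcont : ContinuousOn (fun s => c ⟨i % 4, Nat.mod_lt _ (by norm_num)⟩ * ψ s)
          (uIcc ((i : ℝ) * h) (((i : ℝ) + 1) * h)) := by
        rw [uIcc_of_le hle]
        exact continuousOn_const.mul (hψ.mono hsub)
      push_cast
      refine (hcont.intervalIntegrable).congr_uIoo ?_
      rw [uIoo_of_le hle]
      intro s hs
      simp only [wave_eqOn hh c i hs]
  simpa using key

/-- Integrability of `wave · ψ` on any subinterval `[u, v] ⊆ [0, nh]`. [folklore] -/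
theorem intervalIntegrable_wave_mul_of_mem {h : ℝ} (hh : 0 < h) (c : Fin 4 → ℝ) {ψ : ℝ → ℝ}
    {n : ℕ} (hψ : ContinuousOn ψ (Icc 0 ((n : ℝ) * h))) {u v : ℝ} (hu : u ∈ Icc 0 ((n : ℝ) * h))
    (hv : v ∈ Icc 0 ((n : ℝ) * h)) :
    IntervalIntegrable (fun s => wave c h s * ψ s) volume u v := by
  refine (intervalIntegrable_wave_mul hh c n hψ).mono_set ?_
  rw [uIcc_of_le (by positivity : (0 : ℝ) ≤ (n : ℝ) * h)]
  exact uIcc_subset_Icc hu hv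

/-! ### The averaging estimate (Ożański (4.30)–(4.31)) -/

/-- **One full period.** If `ψ` oscillates by at most `ε` from its value at the left endpoint
over the period `[4ph, (4p+4)h]` and the quarter values `c` have mean zero, then
`|∫_{period} wave c h · ψ| ≤ (max |cⱼ|) · ε · 4h` (the computation (4.30): subtract the left
endpoint value and use `∫_{period} wave = 0`). [cite: Ozanski2017NSIInternal, §4.3 (4.30)] -/
theorem abs_integral_wave_mul_period_le {h : ℝ} (hh : 0 < h) {c : Fin 4 → ℝ} {M : ℝ}
    (hc : ∀ j, |c j| ≤ M) (hsum : ∑ j, c j = 0) {ψ : ℝ → ℝ} {n : ℕ}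
    (hψ : ContinuousOn ψ (Icc 0 ((n : ℝ) * h))) {p : ℕ} (hp : 4 * p + 4 ≤ n) {ε : ℝ}
    (hε : ∀ s ∈ Icc (((4 * p : ℕ) : ℝ) * h) (((4 * p + 4 : ℕ) : ℝ) * h),
      |ψ s - ψ (((4 * p : ℕ) : ℝ) * h)| ≤ ε) :
    |∫ s in (((4 * p : ℕ) : ℝ) * h)..(((4 * p + 4 : ℕ) : ℝ) * h), wave c h s * ψ s| ≤
      M * ε * (4 * h) := by
  set a : ℝ := ((4 * p : ℕ) : ℝ) * h with ha
  set b : ℝ := ((4 * p + 4 : ℕ) : ℝ) * h with hb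
  have hab : a ≤ b := by
    rw [ha, hb]; push_cast; nlinarith
  have hba : b - a = 4 * h := by
    rw [ha, hb]; push_cast; ring
  have ha0 : a ∈ Icc 0 ((n : ℝ) * h) := by
    refine ⟨by positivity, ?_⟩
    have : ((4 * p : ℕ) : ℝ) ≤ n := by exact_mod_cast (by omega : 4 * p ≤ n)
    rw [ha]; nlinarith
  have hb0 : b ∈ Icc 0 ((n : ℝ) * h) := by
    refine ⟨by positivity, ?_⟩
    have : ((4 * p + 4 : ℕ) : ℝ) ≤ n := by exact_mod_cast hp
    rw [hb]; nlinarith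
  -- split `ψ = (ψ - ψ a) + ψ a`
  have hψ' : ContinuousOn (fun s => ψ s - ψ a) (Icc 0 ((n : ℝ) * h)) := hψ.sub continuousOn_const
  have h1 : IntervalIntegrable (fun s => wave c h s * (ψ s - ψ a)) volume a b :=
    intervalIntegrable_wave_mul_of_mem hh c hψ' ha0 hb0
  have h2 : IntervalIntegrable (fun s => wave c h s * ψ a) volume a b :=
    intervalIntegrable_wave_mul_of_mem hh c continuousOn_const ha0 hb0
  have hsplit : ∫ s in a..b, wave c h s * ψ s =
      (∫ s in a..b, wave c h s * (ψ s - ψ a)) + ∫ s in a..b, wave c h s * ψ a := by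
    rw [← intervalIntegral.integral_add h1 h2]
    congr 1
    funext s
    ring
  have hzero : ∫ s in a..b, wave c h s * ψ a = 0 := by
    rw [intervalIntegral.integral_mul_const, ha, hb, integral_wave_period hh c p, hsum]
    ring
  rw [hsplit, hzero, add_zero]
  have hbound : ∀ s ∈ Ι a b, ‖wave c h s * (ψ s - ψ a)‖ ≤ M * ε := by
    intro s hs
    rw [uIoc_of_le hab] at hs
    rw [Real.norm_eq_abs, abs_mul]
    have hs' : s ∈ Icc a b := ⟨hs.1.le, hs.2⟩
    exact mul_le_mul (hc _) (hε s hs') (abs_nonneg _) ((abs_nonneg _).trans (hc 0))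
  have := norm_integral_le_of_norm_le_const hbound
  rw [Real.norm_eq_abs, hba, abs_of_pos (by positivity : (0 : ℝ) < 4 * h)] at this
  linarith

/-- **Ożański's averaging estimate** ((4.30)–(4.31), pp. 18–19). Let `h > 0`, `k ≥ 1` and
`T = 4kh`; let `w = wave c h` be the square wave with quarter values `|cⱼ| ≤ 1` (period
`4h = T/k`), and let `φ` be continuous on `[0,T]` with `|φ| ≤ N` and
`|φ(s) - φ(s')| ≤ ε` whenever `|s - s'| ≤ 4h`. Then for every `t ∈ [0,T]`,
`|∫₀ᵗ w φ - ((c₀+c₁+c₂+c₃)/4) ∫₀ᵗ φ| ≤ 2εT + 2N(4h)`: the `q ≤ k` full periods below `t`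
contribute at most `2ε · 4h` each (`abs_integral_wave_mul_period_le` for the mean-zero values
`cⱼ - mean`), and the incomplete last period at most `2N · 4h`.
[cite: Ozanski2017NSIInternal, §4.3 (4.30)–(4.31)] -/
theorem abs_integral_wave_mul_sub_le {h : ℝ} (hh : 0 < h) {k : ℕ} (hk : 0 < k) {c : Fin 4 → ℝ}
    (hc : ∀ j, |c j| ≤ 1) {φ : ℝ → ℝ} (hφ : ContinuousOn φ (Icc 0 (((4 * k : ℕ) : ℝ) * h)))
    {N ε : ℝ} (hN : ∀ s ∈ Icc 0 (((4 * k : ℕ) : ℝ) * h), |φ s| ≤ N)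
    (hε : ∀ s ∈ Icc 0 (((4 * k : ℕ) : ℝ) * h), ∀ s' ∈ Icc 0 (((4 * k : ℕ) : ℝ) * h),
      |s - s'| ≤ 4 * h → |φ s - φ s'| ≤ ε)
    {t : ℝ} (ht : t ∈ Icc 0 (((4 * k : ℕ) : ℝ) * h)) :
    |(∫ s in 0..t, wave c h s * φ s) - (∑ j, c j) / 4 * ∫ s in 0..t, φ s| ≤
      2 * ε * (((4 * k : ℕ) : ℝ) * h) + 2 * N * (4 * h) := by
  set T : ℝ := ((4 * k : ℕ) : ℝ) * h with hT_def
  have hT : T = 4 * k * h := by rw [hT_def]; push_cast; ring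
  have hTpos : 0 < T := by rw [hT]; positivity
  have h4h : 0 < 4 * h := by positivity
  have hε0 : 0 ≤ ε := by
    have := hε 0 ⟨le_rfl, hTpos.le⟩ 0 ⟨le_rfl, hTpos.le⟩ (by simp; positivity)
    simpa using this
  have hN0 : 0 ≤ N := (abs_nonneg _).trans (hN 0 ⟨le_rfl, hTpos.le⟩)
  -- the mean and the centred quarter values
  set m : ℝ := (∑ j, c j) / 4 with hm_def
  have hm : |m| ≤ 1 := by
    rw [hm_def, abs_div, abs_of_pos (by norm_num : (0 : ℝ) < 4), div_le_one (by norm_num)]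
    calc |∑ j, c j| ≤ ∑ j, |c j| := Finset.abs_sum_le_sum_abs _ _
      _ ≤ ∑ _j : Fin 4, (1 : ℝ) := Finset.sum_le_sum fun j _ => hc j
      _ = 4 := by simp
  set c' : Fin 4 → ℝ := fun j => c j - m with hc'_def
  have hc' : ∀ j, |c' j| ≤ 2 := fun j => by
    calc |c j - m| ≤ |c j| + |m| := abs_sub _ _
      _ ≤ 1 + 1 := add_le_add (hc j) hm
      _ = 2 := by norm_num
  have hsum' : ∑ j, c' j = 0 := by
    simp only [hc'_def, Finset.sum_sub_distrib, Finset.sum_const, Finset.card_univ,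
      Fintype.card_fin, nsmul_eq_mul, hm_def]
    push_cast
    ring
  -- rewrite the difference as one integral of `wave c' · φ`
  have h0T : (0 : ℝ) ∈ Icc 0 T := ⟨le_rfl, hTpos.le⟩
  have hIw : ∀ {u v : ℝ}, u ∈ Icc 0 T → v ∈ Icc 0 T →
      IntervalIntegrable (fun s => wave c h s * φ s) volume u v := fun hu hv =>
    intervalIntegrable_wave_mul_of_mem hh c hφ hu hv
  have hIφ : ∀ {u v : ℝ}, u ∈ Icc 0 T → v ∈ Icc 0 T →
      IntervalIntegrable φ volume u v := fun hu hv =>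
    (hφ.mono (uIcc_subset_Icc hu hv)).intervalIntegrable
  have hIw' : ∀ {u v : ℝ}, u ∈ Icc 0 T → v ∈ Icc 0 T →
      IntervalIntegrable (fun s => wave c' h s * φ s) volume u v := fun hu hv =>
    intervalIntegrable_wave_mul_of_mem hh c' hφ hu hv
  have key : (∫ s in 0..t, wave c h s * φ s) - m * ∫ s in 0..t, φ s =
      ∫ s in 0..t, wave c' h s * φ s := by
    rw [← intervalIntegral.integral_const_mul, ← intervalIntegral.integral_sub (hIw h0T ht)
      ((hIφ h0T ht).const_mul m)]
    congr 1
    funext s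
    rw [wave_sub_const]
    ring
  rw [key]
  -- the number `q` of full periods below `t`
  obtain ⟨q, hq1, hq2, hqk⟩ : ∃ q : ℕ, (q : ℝ) * (4 * h) ≤ t ∧ t < ((q : ℝ) + 1) * (4 * h) ∧ q ≤ k := by
    have ht0 : 0 ≤ t / (4 * h) := div_nonneg ht.1 h4h.le
    have hfl : 0 ≤ ⌊t / (4 * h)⌋ := Int.floor_nonneg.2 ht0
    refine ⟨⌊t / (4 * h)⌋.toNat, ?_, ?_, ?_⟩
    · have h1 : ((⌊t / (4 * h)⌋.toNat : ℤ) : ℝ) = (⌊t / (4 * h)⌋ : ℝ) := by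
        rw [Int.toNat_of_nonneg hfl]
      have h2 : (⌊t / (4 * h)⌋ : ℝ) ≤ t / (4 * h) := Int.floor_le _
      rw [le_div_iff₀ h4h] at h2
      have h3 : ((⌊t / (4 * h)⌋.toNat : ℕ) : ℝ) = (⌊t / (4 * h)⌋ : ℝ) := by exact_mod_cast h1
      rw [h3]; exact h2
    · have h2 : t / (4 * h) < (⌊t / (4 * h)⌋ : ℝ) + 1 := Int.lt_floor_add_one _
      rw [div_lt_iff₀ h4h] at h2
      have h3 : ((⌊t / (4 * h)⌋.toNat : ℕ) : ℝ) = (⌊t / (4 * h)⌋ : ℝ) := by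
        have h1 : ((⌊t / (4 * h)⌋.toNat : ℤ) : ℝ) = (⌊t / (4 * h)⌋ : ℝ) := by
          rw [Int.toNat_of_nonneg hfl]
        exact_mod_cast h1
      rw [h3]; exact h2
    · have h2 : t / (4 * h) ≤ k := by
        rw [div_le_iff₀ h4h]
        have := ht.2
        rw [hT] at this
        linarith
      have h3 : ⌊t / (4 * h)⌋ ≤ (k : ℤ) := by
        have : ⌊t / (4 * h)⌋ ≤ ⌊((k : ℤ) : ℝ)⌋ := Int.floor_le_floor (by exact_mod_cast h2)
        rwa [Int.floor_intCast] at this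
      have h4 : (⌊t / (4 * h)⌋.toNat : ℤ) ≤ k := by
        rw [Int.toNat_of_nonneg hfl]; exact h3
      exact_mod_cast h4
  -- endpoints of the full periods
  have hqT : (q : ℝ) * (4 * h) ∈ Icc 0 T := by
    refine ⟨by positivity, ?_⟩
    rw [hT]
    have : (q : ℝ) ≤ k := by exact_mod_cast hqk
    nlinarith
  have hper_mem : ∀ p : ℕ, p ≤ q → (p : ℝ) * (4 * h) ∈ Icc 0 T := fun p hp => by
    refine ⟨by positivity, ?_⟩
    have : (p : ℝ) ≤ q := by exact_mod_cast hp
    exact le_trans (by nlinarith) hqT.2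
  -- split off the incomplete last period
  rw [← integral_add_adjacent_intervals (b := (q : ℝ) * (4 * h)) (hIw' h0T hqT) (hIw' hqT ht)]
  -- (i) the full periods
  have hfull : |∫ s in 0..(q : ℝ) * (4 * h), wave c' h s * φ s| ≤ 2 * ε * T := by
    have hsum := sum_integral_adjacent_intervals (f := fun s => wave c' h s * φ s) (μ := volume)
      (a := fun p : ℕ => (p : ℝ) * (4 * h)) (n := q) fun p hp =>
        hIw' (hper_mem p hp.le) (by
          have := hper_mem (p + 1) hp
          push_cast at this ⊢
          exact this)
    simp only [Nat.cast_zero, zero_mul] at hsum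
    rw [← hsum]
    have hterm : ∀ p ∈ Finset.range q,
        |∫ s in (p : ℝ) * (4 * h)..((p + 1 : ℕ) : ℝ) * (4 * h), wave c' h s * φ s| ≤
          2 * ε * (4 * h) := by
      intro p hp
      rw [Finset.mem_range] at hp
      have e1 : (p : ℝ) * (4 * h) = ((4 * p : ℕ) : ℝ) * h := by push_cast; ring
      have e2 : ((p + 1 : ℕ) : ℝ) * (4 * h) = ((4 * p + 4 : ℕ) : ℝ) * h := by push_cast; ring
      rw [e1, e2]
      refine abs_integral_wave_mul_period_le hh hc' hsum' hφ (by omega) fun s hs => ?_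
      have hsT : ((4 * p + 4 : ℕ) : ℝ) * h ≤ T := by
        rw [← e2]
        exact (hper_mem (p + 1) (by omega)).2
      have hs0 : 0 ≤ ((4 * p : ℕ) : ℝ) * h := by positivity
      refine hε s ⟨hs0.trans hs.1, hs.2.trans hsT⟩ _ ⟨hs0, (hs.1.trans hs.2).trans hsT⟩ ?_
      rw [abs_of_nonneg (sub_nonneg.2 hs.1)]
      have : ((4 * p + 4 : ℕ) : ℝ) * h = ((4 * p : ℕ) : ℝ) * h + 4 * h := by push_cast; ring
      linarith [hs.2]
    calc |∑ p ∈ Finset.range q, ∫ s in (p : ℝ) * (4 * h)..((p + 1 : ℕ) : ℝ) * (4 * h),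
            wave c' h s * φ s|
        ≤ ∑ p ∈ Finset.range q, |∫ s in (p : ℝ) * (4 * h)..((p + 1 : ℕ) : ℝ) * (4 * h),
            wave c' h s * φ s| := Finset.abs_sum_le_sum_abs _ _
      _ ≤ ∑ _p ∈ Finset.range q, 2 * ε * (4 * h) := Finset.sum_le_sum hterm
      _ = q * (2 * ε * (4 * h)) := by rw [Finset.sum_const, Finset.card_range, nsmul_eq_mul]
      _ ≤ k * (2 * ε * (4 * h)) := by
          have : (q : ℝ) ≤ k := by exact_mod_cast hqk
          exact mul_le_mul_of_nonneg_right this (by positivity)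
      _ = 2 * ε * T := by rw [hT]; ring
  -- (ii) the incomplete last period
  have hrest : |∫ s in (q : ℝ) * (4 * h)..t, wave c' h s * φ s| ≤ 2 * N * (4 * h) := by
    have hbound : ∀ s ∈ Ι ((q : ℝ) * (4 * h)) t, ‖wave c' h s * φ s‖ ≤ 2 * N := by
      intro s hs
      rw [uIoc_of_le hq1] at hs
      rw [Real.norm_eq_abs, abs_mul]
      exact mul_le_mul (hc' _) (hN s ⟨hqT.1.trans hs.1.le, hs.2.trans ht.2⟩) (abs_nonneg _)
        (by norm_num)
    have h1 := norm_integral_le_of_norm_le_const hbound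
    rw [Real.norm_eq_abs, abs_of_nonneg (sub_nonneg.2 hq1)] at h1
    have h2 : t - (q : ℝ) * (4 * h) ≤ 4 * h := by nlinarith
    calc |∫ s in (q : ℝ) * (4 * h)..t, wave c' h s * φ s| ≤ 2 * N * (t - (q : ℝ) * (4 * h)) := h1
      _ ≤ 2 * N * (4 * h) := mul_le_mul_of_nonneg_left h2 (by positivity)
  calc |(∫ s in 0..(q : ℝ) * (4 * h), wave c' h s * φ s) +
          ∫ s in (q : ℝ) * (4 * h)..t, wave c' h s * φ s|
      ≤ |∫ s in 0..(q : ℝ) * (4 * h), wave c' h s * φ s| +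
          |∫ s in (q : ℝ) * (4 * h)..t, wave c' h s * φ s| := abs_add_le _ _
    _ ≤ 2 * ε * T + 2 * N * (4 * h) := add_le_add hfull hrest

end Scheffer

end Literature.Barriers.NavierStokesRegularity
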